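import Summits.QuantumFields.YangMills.Theorems.FlatTubeReductionNearFlatRatioLaw
import Summits.QuantumFields.YangMills.Theorems.FemtoCutoffLadderFixedLatticeLawOfNearFlat
import Summits.QuantumFields.YangMills.Theorems.FemtoCutoffLadderCoarsePairScalingGlue
import HarnessLib

/-!
# ★★★★ Crux `CoarsePairScaling` of route `FemtoCutoffLadder` (stmt-QuantumFields-23866, rank 3 — a binder of the route's deciding theorem) CLOSED
# from its glued split: `FixedLatticeLaw` (23943, proved — `Theorems/FemtoCutoffLadderFixedLatticeLaw.lean`) ∧ `OneSiteGapUpper` (23944, proved) via the glue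
# `CoarsePairScalingGlue` (23945, proved)
# (seat `ym-line-ftr-p1` g21; R2b1 RECORD rung — no summit statement is proved here)

`CoarsePairScaling`: for every fixed `L`, deep in the femto window at matched running parameter, the one-sided coarse comparison against the one-site
problem `λ₁(β,L)^L·λ₀(β′,1) ≤ exp(C_L Λ²)·λ₁(β′,1)·λ₀(β,L)^L`.  It is the registered split's parent:
★★★★ `coarsePairScaling_proof := coarsePairScalingGlue_proof (fixedLatticeLaw_of_nearFlat nearFlatRatioLaw_proof) oneSiteGapUpper_proof` — the first argument is, by
definition, `FemtoCutoffLadder.fixedLatticeLaw_proof` of the sibling file `Theorems/FemtoCutoffLadderFixedLatticeLaw.lean` (spelled inline so that this leaf does not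
wait on / depend on that module).
After this file the deciding theorem `Theses.FemtoCutoffLadder.closes` has exactly two open binders, `OctaveStepDecay` (24153) and `UpStepEv` (26796) — the same two
as route `FlatTubeReduction`.  HONEST FRAMING: fixed-`L` statements with `L`-dependent constants; NOT uniform in `L`, NOT infinite volume, NOT a mass gap, NOT Clay;
rung R2b1 (`FemtoGapOfRecord`) stays OPEN; no summit statement is proved here.  No `sorry`, no definitions, no named-fact hypotheses.
-/

set_option autoImplicit false

namespace Summit.QuantumFields.YangMills.Theorems.FemtoCutoffLadder

/-- ★★★★ **Crux `CoarsePairScaling` (stmt-QuantumFields-23866) BY NAME**: the proved glue `coarsePairScalingGlue_proof : FixedLatticeLaw → OneSiteGapUpper →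
CoarsePairScaling` applied to the proved children `FixedLatticeLaw` (23943: the landed glue `fixedLatticeLaw_of_nearFlat` — K2 off-tube suppression inside — on the
proved crux K1 `FlatTubeReduction.nearFlatRatioLaw_proof`; definitionally the sibling file's `fixedLatticeLaw_proof`) and `oneSiteGapUpper_proof` (23944).
[cite: Luscher1983, §3] [cite: LuscherMunster1984, §2] -/
theorem coarsePairScaling_proof : Summit.QuantumFields.YangMills.Theses.FemtoCutoffLadder.CoarsePairScaling :=
  coarsePairScalingGlue_proof
    (fixedLatticeLaw_of_nearFlat Summit.QuantumFields.YangMills.Theorems.FlatTubeReduction.nearFlatRatioLaw_proof)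
    oneSiteGapUpper_proof

end Summit.QuantumFields.YangMills.Theorems.FemtoCutoffLadder
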